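import Literature.Computability.Complexity.StackStreams
import Literature.Computability.Complexity.BoolEncodings
import HarnessLib

/-!
# Fixed-width words on stack registers: emission by parts, counters, addition, unary conversion

Trunk `CplxCore`, toolkit continuing `StackStreams.lean` (`countLoop`, the list coding read by
`readItem`) and `StackLists.lean` (`emit`, `outRev`). The table algorithms of Williams'
evaluation lemma (Williams 2014, Lemma 4.2 / App. C) keep their entries as WORDS OF A FIXED
WIDTH (least significant bit first), so that records can be cut at known positions and sorted
bit by bit (`StackRadixSort.lean`), unlike the canonical variable-length numerals of the
word-RAM unit `StackWordArith.lean`. This file provides the word layer, generic in the register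
type, every routine with its exact effect and a linear step count:

* words: `natToWord w v` (the `w` low bits of `v`), `bitsToNat_natToWord` (`= v mod 2ʷ`),
  `natToWord_bitsToNat`, `natToWord_succ`, `natToWord_inj_iff`, `bitsToNat_injOn_length`,
  `testBit_bitsToNat_eq_getD`;
* emission of an element in parts: `Com.emitPart h o` (payload bits, `4 |h| + 1`), `Com.emitSep o`
  (separator, `2`), `reverse_dbl_append` / `outRev_append_eq` (a record `p₁ ++ ⋯ ++ p_k` is
  emitted by `k` parts and one separator);
* under a unary count `1ⁱ` on `U` (tokens parked on `V`): `Com.dropBits` (`A := A.drop i`,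
  `5 i + 1`), `Com.fillFalse` (`A := 0ⁱ ++ A`, `4 i + 1`);
* `Com.incrWord A T w` — increment in place modulo `2^{|A|}` (model `incrSpec`,
  `bitsToNat_incrSpec`, `incrSpec_natToWord`; `9 |A| + 8` steps);
* `Com.addWords A C D cy` — ripple-carry addition `A := A + C mod 2^{|A|}` (model `addBits` with
  the full adder `sumBit`/`carryBit`, `bitsToNat_addBits`, `addBits_natToWord`; `11 |A| + 5`);
* `Com.binToUnary A N N2` — Horner conversion of a most-significant-bit-first bit string (as
  left by `readItem` on a numeral) into a unary counter (model `msbVal`,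
  `msbVal_reverse_encodeNat`; `|u| (7 V + 5) + 1` steps, `V` the value), via `Com.dblUnary`.

## References

* D. E. Knuth, *The Art of Computer Programming*, Vol. 2, 3rd ed., Addison–Wesley 1998, §4.3.1
  (Algorithm A, addition of nonnegative integers digit by digit with carry) and §4.4 (radix
  conversion by Horner's rule). (Folklore material, fully proved here.)
* R. Williams, *Nonuniform ACC circuit lower bounds*, J. ACM 61(1) (2014), App. C (fixed-width
  fields of the table entries) [Williams2014].
* T. Nipkow, G. Klein, *Concrete Semantics with Isabelle/HOL*, Springer 2014, §7.2 — the
  verification style of `StackPrograms.lean`.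
-/

namespace Literature.Computability.Complexity

open SProg

/-! ### Words of a fixed width -/

/-- The `w`-bit word of `v`, least significant bit first (bits beyond the width are dropped).
[folklore] -/
def natToWord (w v : ℕ) : List Bool := List.ofFn fun i : Fin w => v.testBit i

/-- A `w`-bit word has length `w`. [folklore] -/
@[simp] theorem length_natToWord (w v : ℕ) : (natToWord w v).length = w := List.length_ofFn

/-- Bit `i < w` of the word of `v` is bit `i` of `v`. [folklore] -/
theorem getElem_natToWord (w v : ℕ) (i : ℕ) (h : i < (natToWord w v).length) :
    (natToWord w v)[i] = v.testBit i := by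
  simp [natToWord]

/-- One more bit of width: append bit `w`. [folklore] -/
theorem natToWord_succ (w v : ℕ) : natToWord (w + 1) v = natToWord w v ++ [v.testBit w] := by
  unfold natToWord
  rw [List.ofFn_succ']
  simp [List.concat_eq_append]

/-- `bitsToNat` reads bits: bit `i` of the value is entry `i` of the list (a twin of
`testBit_bitsToNat` of `StackWordArith.lean` / `ShorOrdPost.lean`, not imported here to keep this
layer below the word-RAM unit). [folklore] -/
theorem testBit_bitsToNat_eq_getD (u : List Bool) (i : ℕ) : (bitsToNat u).testBit i = u.getD i false := by
  induction u generalizing i with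
  | nil => simp
  | cons b u ih =>
    cases i with
    | zero =>
      rw [bitsToNat_cons, Nat.testBit_zero]
      cases b <;> simp [Nat.add_mod]
    | succ i =>
      rw [bitsToNat_cons, Nat.testBit_succ, List.getD_cons_succ, ← ih]
      congr 1
      cases b <;> simp [Nat.add_mul_div_left]

/-- The word of the value of a list of length `w` is the list. [folklore] -/
theorem natToWord_bitsToNat (u : List Bool) : natToWord u.length (bitsToNat u) = u := by
  refine List.ext_getElem (by simp) fun i h₁ h₂ => ?_
  rw [getElem_natToWord, testBit_bitsToNat_eq_getD, List.getD_eq_getElem?_getD,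
    List.getElem?_eq_getElem h₂, Option.getD_some]

/-- The value of the `w`-bit word of `v` is `v mod 2ʷ`. [folklore] -/
theorem bitsToNat_natToWord (w v : ℕ) : bitsToNat (natToWord w v) = v % 2 ^ w := by
  refine Nat.eq_of_testBit_eq fun i => ?_
  rw [testBit_bitsToNat_eq_getD, Nat.testBit_mod_two_pow, List.getD_eq_getElem?_getD]
  by_cases hi : i < w
  · rw [List.getElem?_eq_getElem (by simpa using hi), Option.getD_some, getElem_natToWord]
    simp [hi]
  · rw [List.getElem?_eq_none (by simpa using hi)]
    simp [hi]

/-- For `v < 2ʷ` the word carries `v` exactly. [folklore] -/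
theorem bitsToNat_natToWord_of_lt {w v : ℕ} (h : v < 2 ^ w) : bitsToNat (natToWord w v) = v := by
  rw [bitsToNat_natToWord, Nat.mod_eq_of_lt h]

/-- Words of one width are equal iff the values agree modulo `2ʷ`. [folklore] -/
theorem natToWord_inj_iff {w v v' : ℕ} : natToWord w v = natToWord w v' ↔ v % 2 ^ w = v' % 2 ^ w := by
  constructor
  · intro h; rw [← bitsToNat_natToWord, ← bitsToNat_natToWord, h]
  · intro h
    refine List.ext_getElem (by simp) fun i h₁ h₂ => ?_
    rw [getElem_natToWord, getElem_natToWord]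
    have := congrArg (fun x => x.testBit i) h
    simp only [Nat.testBit_mod_two_pow] at this
    rw [length_natToWord] at h₁
    simpa [h₁] using this

/-- `bitsToNat` is injective on lists of a fixed length. [folklore] -/
theorem bitsToNat_injOn_length (w : ℕ) :
    Set.InjOn bitsToNat {u : List Bool | u.length = w} := by
  intro u hu u' hu' h
  rw [← natToWord_bitsToNat u, ← natToWord_bitsToNat u', h]
  simp only [Set.mem_setOf_eq] at hu hu'
  rw [hu, hu']

namespace Com

variable {ι : Type} [DecidableEq ι]

/-! ### Emitting an element in several parts -/

/-- `emitPart h o`: push the bits of `h` (consumed) doubled onto `o` — the payload of an element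
being emitted, possibly in several parts before the separator `emitSep`. [folklore] -/
def emitPart (h o : ι) : Com ι := loop h (push o true ;; push o true) (push o false ;; push o false)

/-- `emitSep o`: push the separator, completing the element. [folklore] -/
def emitSep (o : ι) : Com ι := push o false ;; push o true

/-- Effect of `emitPart`: `o := (dbl h)ʳ ++ o`, `h` emptied, `4 |h| + 1` steps. [folklore] -/
theorem runs_emitPart {h o : ι} (hho : h ≠ o) (R : Regs ι) :
    Runs (emitPart h o) R
      (Function.update (Function.update R h []) o ((dbl (R h)).reverse ++ R o)) (4 * (R h).length + 1) := by
  suffices H : ∀ (v : List Bool) (R : Regs ι), R h = v → Runs (emitPart h o) R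
      (Function.update (Function.update R h []) o ((dbl v).reverse ++ R o)) (4 * v.length + 1) from
    H _ R rfl
  intro v
  induction v with
  | nil =>
    intro R hv
    refine (Runs.loop_nil _ _ hv).of_eq ?_ (by simp)
    ext i : 1; simp only [Function.update_apply]; split_ifs <;> simp_all
  | cons b v ih =>
    intro R hv
    have hb : Runs (bif b then (push o true ;; push o true) else (push o false ;; push o false))
        (Function.update R h v) (Function.update (Function.update R h v) o (b :: b :: R o)) 2 := by
      cases b
      · refine ((Runs.push o false _).seq (Runs.push o false _)).of_eq ?_ (by rfl)
        ext i : 1; simp only [Function.update_apply]; split_ifs <;> simp_all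
      · refine ((Runs.push o true _).seq (Runs.push o true _)).of_eq ?_ (by rfl)
        ext i : 1; simp only [Function.update_apply]; split_ifs <;> simp_all
    have ih' := ih (Function.update (Function.update R h v) o (b :: b :: R o))
      (by simp only [Function.update_apply]; split_ifs <;> simp_all)
    have hfin : Function.update (Function.update (Function.update (Function.update R h v) o
        (b :: b :: R o)) h []) o ((dbl v).reverse ++ Function.update (Function.update R h v) o
        (b :: b :: R o) o) = Function.update (Function.update R h []) o ((dbl (b :: v)).reverse ++ R o) := by
      ext i : 1; simp only [Function.update_apply]; split_ifs <;> simp_all [dbl]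
    rw [hfin] at ih'
    cases b
    · exact (Runs.loop_false hv hb ih').of_eq rfl (by simp; omega)
    · exact (Runs.loop_true hv hb ih').of_eq rfl (by simp; omega)

/-- Effect of `emitSep`: `o := 1 :: 0 :: o`, `2` steps. [folklore] -/
theorem runs_emitSep (o : ι) (R : Regs ι) :
    Runs (emitSep o) R (Function.update R o (true :: false :: R o)) 2 := by
  refine ((Runs.push o false _).seq (Runs.push o true _)).of_eq ?_ (by rfl)
  ext i : 1; simp only [Function.update_apply]; split_ifs <;> simp_all

/-- **Emission by parts**: after the parts `p₁, …, p_k` have been pushed by `emitPart` onto a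
reversed output `outRev E` (in this order) and the separator by `emitSep`, the output is
`outRev (E ++ [p₁ ++ ⋯ ++ p_k])`; this lemma is the bookkeeping step for one more part. [folklore] -/
theorem reverse_dbl_append (p q : List Bool) :
    (dbl (p ++ q)).reverse = (dbl q).reverse ++ (dbl p).reverse := by
  simp [dbl, List.flatMap_append]

/-- The completed element. [folklore] -/
theorem outRev_append_eq (E : List (List Bool)) (a : List Bool) :
    outRev (E ++ [a]) = true :: false :: ((dbl a).reverse ++ outRev E) := outRev_append E a

/-! ### Dropping bits and filling zeros under a unary count -/

/-- `dropBits A U V`: pop one bit of `A` per token of `U` (nothing once `A` is exhausted),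
parking the tokens on `V`. [folklore] -/
def dropBits (A U V : ι) : Com ι := countLoop U (pop A (push V true) (push V true) (push V true))

/-- Effect of `dropBits`: `A := A.drop i`, `U` emptied, `1ⁱ` parked on `V`; `5 i + 1` steps.
[folklore] -/
theorem runs_dropBits {A U V : ι} (hAU : A ≠ U) (hAV : A ≠ V) (hUV : U ≠ V) :
    ∀ (i : ℕ) (R : Regs ι), R U = List.replicate i true →
      Runs (dropBits A U V) R (Function.update (Function.update (Function.update R U [])
        A ((R A).drop i)) V (List.replicate i true ++ R V)) (5 * i + 1)
  | 0, R, hU => by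
    refine (Runs.loop_nil _ _ hU).of_eq ?_ (by omega)
    ext j : 1; simp only [Function.update_apply]; split_ifs <;> simp_all
  | i + 1, R, hU => by
    have hk : R U = true :: List.replicate i true := by rw [hU, List.replicate_succ]
    set R₁ : Regs ι := Function.update (Function.update (Function.update R U (List.replicate i true))
      A ((R A).drop 1)) V (true :: R V) with hR₁
    have hb : Runs (pop A (push V true) (push V true) (push V true))
        (Function.update R U (List.replicate i true)) R₁ 3 := by
      cases hA : R A with
      | nil =>
        refine (Runs.pop_nil _ _ (by simp only [Function.update_apply]; split_ifs <;> simp_all) (Runs.push V true _)).of_eq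
          ?_ (by omega)
        rw [hR₁]; ext j : 1; simp only [Function.update_apply]; split_ifs <;> simp_all
      | cons b rest =>
        cases b
        · refine (Runs.pop_false _ _ (w := rest) (by simp only [Function.update_apply]; split_ifs <;> simp_all)
            (Runs.push V true _)).of_eq ?_ (by omega)
          rw [hR₁]; ext j : 1; simp only [Function.update_apply]; split_ifs <;> simp_all
        · refine (Runs.pop_true _ _ (w := rest) (by simp only [Function.update_apply]; split_ifs <;> simp_all)
            (Runs.push V true _)).of_eq ?_ (by omega)
          rw [hR₁]; ext j : 1; simp only [Function.update_apply]; split_ifs <;> simp_all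
    have ih := runs_dropBits hAU hAV hUV i R₁
      (by rw [hR₁]; simp only [Function.update_apply]; split_ifs <;> simp_all)
    refine (Runs.loop_true hk hb ih).of_eq ?_ (by omega)
    rw [hR₁]
    clear hk hb ih hU
    ext j : 1; simp only [Function.update_apply]
    split_ifs <;> simp_all [List.replicate_succ']

/-- `fillFalse A U V`: push one `0` on `A` per token of `U`, parking the tokens on `V`. [folklore] -/
def fillFalse (A U V : ι) : Com ι := countLoop U (push A false ;; push V true)

/-- Effect of `fillFalse`: `A := 0ⁱ ++ A`; `4 i + 1` steps. [folklore] -/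
theorem runs_fillFalse {A U V : ι} (hAU : A ≠ U) (hAV : A ≠ V) (hUV : U ≠ V) :
    ∀ (i : ℕ) (R : Regs ι), R U = List.replicate i true →
      Runs (fillFalse A U V) R (Function.update (Function.update (Function.update R U [])
        A (List.replicate i false ++ R A)) V (List.replicate i true ++ R V)) (4 * i + 1)
  | 0, R, hU => by
    refine (Runs.loop_nil _ _ hU).of_eq ?_ (by omega)
    ext j : 1; simp only [Function.update_apply]; split_ifs <;> simp_all
  | i + 1, R, hU => by
    have hk : R U = true :: List.replicate i true := by rw [hU, List.replicate_succ]
    set R₁ : Regs ι := Function.update (Function.update (Function.update R U (List.replicate i true))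
      A (false :: R A)) V (true :: R V) with hR₁
    have hb : Runs (push A false ;; push V true) (Function.update R U (List.replicate i true)) R₁ 2 := by
      refine ((Runs.push A false _).seq (Runs.push V true _)).of_eq ?_ (by rfl)
      rw [hR₁]; ext j : 1; simp only [Function.update_apply]; split_ifs <;> simp_all
    have ih := runs_fillFalse hAU hAV hUV i R₁
      (by rw [hR₁]; simp only [Function.update_apply]; split_ifs <;> simp_all)
    refine (Runs.loop_true hk hb ih).of_eq ?_ (by omega)
    rw [hR₁]
    clear hk hb ih hU
    ext j : 1; simp only [Function.update_apply]
    split_ifs <;> simp_all [List.replicate_succ']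

/-! ### Incrementing a word in place -/

/-- The successor of a word modulo `2^{|u|}` (least significant bit first): leading ones become
zeros, the first zero becomes a one. [folklore] -/
def incrSpec : List Bool → List Bool
  | [] => []
  | true :: u => false :: incrSpec u
  | false :: u => true :: u

/-- `incrSpec` keeps the length. [folklore] -/
@[simp] theorem length_incrSpec : ∀ u : List Bool, (incrSpec u).length = u.length
  | [] => rfl
  | true :: u => by simp [incrSpec, length_incrSpec u]
  | false :: u => rfl

/-- **`incrSpec` is the successor modulo `2^{|u|}`.** [folklore] -/
theorem bitsToNat_incrSpec : ∀ u : List Bool, bitsToNat (incrSpec u) = (bitsToNat u + 1) % 2 ^ u.length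
  | [] => rfl
  | true :: u => by
    rw [incrSpec, bitsToNat_cons, bitsToNat_cons, bitsToNat_incrSpec u, List.length_cons, pow_succ]
    simp only [Bool.toNat_false, Bool.toNat_true, zero_add]
    rw [show 1 + 2 * bitsToNat u + 1 = 2 * (bitsToNat u + 1) by ring, mul_comm (2 ^ u.length) 2,
      Nat.mul_mod_mul_left]
  | false :: u => by
    rw [incrSpec, bitsToNat_cons, bitsToNat_cons, List.length_cons, pow_succ]
    simp only [Bool.toNat_false, Bool.toNat_true, zero_add]
    have := bitsToNat_lt u
    rw [Nat.mod_eq_of_lt (by omega)]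
    omega

/-- On the word of `v` the increment gives the word of `v + 1`. [folklore] -/
theorem incrSpec_natToWord (w v : ℕ) : incrSpec (natToWord w v) = natToWord w (v + 1) := by
  have h := natToWord_bitsToNat (incrSpec (natToWord w v))
  rw [length_incrSpec, length_natToWord, bitsToNat_incrSpec, length_natToWord,
    bitsToNat_natToWord] at h
  rw [← h, natToWord_inj_iff]
  simp [Nat.add_mod]

/-- The number of leading ones. [folklore] -/
def onesPrefix : List Bool → ℕ
  | true :: u => onesPrefix u + 1
  | _ => 0

/-- The word after the carry loop: leading ones removed, first zero set. [folklore] -/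
def incrRest : List Bool → List Bool
  | [] => []
  | true :: u => incrRest u
  | false :: u => true :: u

/-- `incrSpec` = zeros for the leading ones, then `incrRest`. [folklore] -/
theorem incrSpec_eq : ∀ u : List Bool, incrSpec u = List.replicate (onesPrefix u) false ++ incrRest u
  | [] => rfl
  | true :: u => by rw [incrSpec, onesPrefix, incrRest, List.replicate_succ, List.cons_append, incrSpec_eq u]
  | false :: u => rfl

/-- `onesPrefix` is at most the length. [folklore] -/
theorem onesPrefix_le : ∀ u : List Bool, onesPrefix u ≤ u.length
  | [] => le_rfl
  | true :: u => by simp [onesPrefix, onesPrefix_le u]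
  | false :: u => Nat.zero_le _

/-- The body of the carry loop: a `1` becomes a parked `0` (continue), a `0` becomes a `1`
(stop), an exhausted word stops. [folklore] -/
def incrBody (A T w : ι) : Com ι := pop A (push T false ;; push w true) (push A true) skip

/-- `incrWord A T w`: increment the word in `A` (least significant bit on top) modulo
`2^{|A|}`, using the empty scratch `T` and the token register `w`. [folklore] -/
def incrWord (A T w : ι) : Com ι := push w true ;; loop w (incrBody A T w) skip ;; pour T A

/-- The carry loop. [folklore] -/
theorem runs_incrWordLoop {A T w : ι} (hAT : A ≠ T) (hAw : A ≠ w) (hTw : T ≠ w) :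
    ∀ (u : List Bool) (R : Regs ι), R A = u → R w = [true] →
      Runs (loop w (incrBody A T w) skip) R
        (Function.update (Function.update (Function.update R w []) A (incrRest u)) T
          (List.replicate (onesPrefix u) false ++ R T)) (6 * onesPrefix u + 6)
  | [], R, hA, hw => by
    have hb : Runs (incrBody A T w) (Function.update R w []) (Function.update R w []) 2 :=
      Runs.pop_nil _ _ (by simp only [Function.update_apply]; split_ifs <;> simp_all) (Runs.skip _)
    refine (Runs.loop_true hw hb (Runs.loop_nil _ _ (by simp))).of_eq ?_ (by simp [onesPrefix])
    ext j : 1; simp only [Function.update_apply]; split_ifs <;> simp_all [incrRest, onesPrefix]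
  | true :: u, R, hA, hw => by
    set R₁ : Regs ι := Function.update (Function.update (Function.update (Function.update R w []) A u)
      T (false :: R T)) w [true] with hR₁
    have hb : Runs (incrBody A T w) (Function.update R w []) R₁ 4 := by
      refine (Runs.pop_true _ _ (w := u) (by simp only [Function.update_apply]; split_ifs <;> simp_all)
        ((Runs.push T false _).seq (Runs.push w true _))).of_eq ?_ (by rfl)
      rw [hR₁]; ext j : 1; simp only [Function.update_apply]; split_ifs <;> simp_all
    have ih := runs_incrWordLoop hAT hAw hTw u R₁
      (by rw [hR₁]; simp only [Function.update_apply]; split_ifs <;> simp_all) (by rw [hR₁]; simp)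
    refine (Runs.loop_true hw hb ih).of_eq ?_ (by simp [onesPrefix]; omega)
    rw [hR₁]
    clear hb ih hw
    ext j : 1; simp only [Function.update_apply]
    split_ifs <;> simp_all [incrRest, onesPrefix, List.replicate_succ']
  | false :: u, R, hA, hw => by
    have hb : Runs (incrBody A T w) (Function.update R w [])
        (Function.update (Function.update R w []) A (true :: u)) 3 := by
      refine (Runs.pop_false _ _ (w := u) (by simp only [Function.update_apply]; split_ifs <;> simp_all)
        (Runs.push A true _)).of_eq ?_ (by rfl)
      ext j : 1; simp only [Function.update_apply]; split_ifs <;> simp_all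
    refine (Runs.loop_true hw hb (Runs.loop_nil _ _
      (by simp only [Function.update_apply]; split_ifs <;> simp_all))).of_eq ?_ (by simp [onesPrefix])
    ext j : 1; simp only [Function.update_apply]; split_ifs <;> simp_all [incrRest, onesPrefix]

/-- **Effect of `incrWord`**: `A := incrSpec A` (the successor modulo `2^{|A|}`,
`bitsToNat_incrSpec`; on `natToWord w v` the word of `v + 1`, `incrSpec_natToWord`), `T` and
`w` empty again, within `9 |A| + 8` steps. [folklore] -/
theorem runs_incrWord {A T w : ι} (hAT : A ≠ T) (hAw : A ≠ w) (hTw : T ≠ w) (R : Regs ι)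
    (hT : R T = []) (hw : R w = []) :
    Runs (incrWord A T w) R (Function.update R A (incrSpec (R A))) (9 * (R A).length + 8) := by
  have h1 : Runs (push w true) R (Function.update R w [true]) 1 := Runs.push' (by rw [hw])
  have h2 := runs_incrWordLoop hAT hAw hTw (R A) (Function.update R w [true])
    (by simp only [Function.update_apply]; split_ifs <;> simp_all) (by simp)
  set R₂ := Function.update (Function.update (Function.update (Function.update R w [true]) w []) A
    (incrRest (R A))) T (List.replicate (onesPrefix (R A)) false ++ Function.update R w [true] T) with hR₂
  have h3 := runs_pour hAT.symm R₂
  refine (h1.seq (h2.seq h3)).of_eq ?_ ?_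
  · rw [hR₂, incrSpec_eq]
    ext j : 1; simp only [Function.update_apply]; split_ifs <;> simp_all
  · have := onesPrefix_le (R A)
    rw [hR₂]; simp only [Function.update_apply]; split_ifs <;> simp_all; omega

/-! ### Binary (most significant bit first) to unary -/

/-- The value of a bit string read most significant bit first. [folklore] -/
def msbVal : List Bool → ℕ
  | [] => 0
  | b :: u => b.toNat * 2 ^ u.length + msbVal u

/-- `msbVal` is `bitsToNat` of the reversal (so `msbVal (encodeNat k)ʳ = k`). [folklore] -/
theorem msbVal_eq_bitsToNat_reverse : ∀ u : List Bool, msbVal u = bitsToNat u.reverse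
  | [] => rfl
  | b :: u => by
    rw [msbVal, List.reverse_cons, bitsToNat_append, ← msbVal_eq_bitsToNat_reverse u,
      List.length_reverse, bitsToNat_cons, bitsToNat_nil]
    ring

/-- `msbVal` of a reversed numeral. [folklore] -/
theorem msbVal_reverse_encodeNat (k : ℕ) : msbVal (Computability.encodeNat k).reverse = k := by
  rw [msbVal_eq_bitsToNat_reverse, List.reverse_reverse, bitsToNat_encodeNat]

/-- `dblUnary N N2`: double the unary counter `N` (pour it onto the empty `N2`, push two tokens
per token back). [folklore] -/
def dblUnary (N N2 : ι) : Com ι :=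
  pour N N2 ;; loop N2 (push N true ;; push N true) (push N true ;; push N true)

/-- Effect of `dblUnary`: `N := 1^{2m}`, `7 m + 2` steps. [folklore] -/
theorem runs_dblUnary {N N2 : ι} (hN : N ≠ N2) (m : ℕ) (R : Regs ι)
    (hNv : R N = List.replicate m true) (hN2 : R N2 = []) :
    Runs (dblUnary N N2) R (Function.update R N (List.replicate (2 * m) true)) (7 * m + 2) := by
  have h1 := runs_pour hN R
  rw [hNv, hN2, List.append_nil, List.reverse_replicate, List.length_replicate] at h1
  have hloop : ∀ (k : ℕ) (S : Regs ι) (j : ℕ), S N2 = List.replicate k true → S N = List.replicate j true →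
      Runs (loop N2 (push N true ;; push N true) (push N true ;; push N true)) S
        (Function.update (Function.update S N2 []) N (List.replicate (2 * k + j) true)) (4 * k + 1) := by
    intro k
    induction k with
    | zero =>
      intro S j hS2 hS
      refine (Runs.loop_nil _ _ hS2).of_eq ?_ (by omega)
      ext i : 1; simp only [Function.update_apply]; split_ifs <;> simp_all
    | succ k ih =>
      intro S j hS2 hS
      have hk : S N2 = true :: List.replicate k true := by rw [hS2, List.replicate_succ]
      have hb : Runs (push N true ;; push N true) (Function.update S N2 (List.replicate k true))
          (Function.update (Function.update S N2 (List.replicate k true)) N (List.replicate (j + 2) true)) 2 := by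
        refine ((Runs.push N true _).seq (Runs.push N true _)).of_eq ?_ (by rfl)
        ext i : 1; simp only [Function.update_apply]; split_ifs <;> simp_all [List.replicate_succ]
      have ih' := ih (Function.update (Function.update S N2 (List.replicate k true)) N
        (List.replicate (j + 2) true)) (j + 2)
        (by simp only [Function.update_apply]; split_ifs <;> simp_all) (by simp)
      refine (Runs.loop_true hk hb ih').of_eq ?_ (by omega)
      ext i : 1; simp only [Function.update_apply]
      split_ifs <;> simp_all [show 2 * (k + 1) + j = 2 * k + (j + 2) by ring]
  have h2 := hloop m (Function.update (Function.update R N []) N2 (List.replicate m true)) 0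
    (by simp) (by simp only [Function.update_apply]; split_ifs <;> simp_all)
  refine (h1.seq h2).of_eq ?_ (by omega)
  ext i : 1; simp only [Function.update_apply]; split_ifs <;> simp_all

/-- `binToUnary A N N2`: read the bits of `A` most significant first (consumed), doubling the
unary counter `N` and adding the bit (Horner). [folklore] -/
def binToUnary (A N N2 : ι) : Com ι :=
  loop A (dblUnary N N2 ;; push N true) (dblUnary N N2)

/-- **Effect of `binToUnary`**: from `A = u` (most significant bit first), `N = 1ᵐ`, `N2`
empty, it leaves `A` empty and `N = 1^V` with `V = m · 2^{|u|} + msbVal u`, within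
`|u| (7 V + 5) + 1` steps (so `O(value · bits)`; from `m = 0`, `N := 1^{msbVal u}`). [folklore] -/
theorem runs_binToUnary {A N N2 : ι} (hAN : A ≠ N) (hAN2 : A ≠ N2) (hN : N ≠ N2) :
    ∀ (u : List Bool) (m : ℕ) (R : Regs ι), R A = u → R N = List.replicate m true → R N2 = [] →
      Runs (binToUnary A N N2) R
        (Function.update (Function.update R A []) N
          (List.replicate (m * 2 ^ u.length + msbVal u) true))
        (u.length * (7 * (m * 2 ^ u.length + msbVal u) + 5) + 1)
  | [], m, R, hA, hNv, hN2 => by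
    refine (Runs.loop_nil _ _ hA).of_eq ?_ (by simp)
    ext i : 1; simp only [Function.update_apply]; split_ifs <;> simp_all [msbVal]
  | b :: u, m, R, hA, hNv, hN2 => by
    set V := m * 2 ^ (b :: u).length + msbVal (b :: u) with hV
    have hmV : m ≤ V := by
      rw [hV]; exact le_trans (Nat.le_mul_of_pos_right m (Nat.two_pow_pos _)) (Nat.le_add_right _ _)
    -- the body: double, and add the bit
    set m' := 2 * m + b.toNat with hm'
    set R₁ : Regs ι := Function.update (Function.update R A u) N (List.replicate m' true) with hR₁
    have hb : Runs (bif b then (dblUnary N N2 ;; push N true) else dblUnary N N2)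
        (Function.update R A u) R₁ (7 * m + 3) := by
      have hd := runs_dblUnary hN m (Function.update R A u)
        (by simp only [Function.update_apply]; split_ifs <;> simp_all)
        (by simp only [Function.update_apply]; split_ifs <;> simp_all)
      cases b with
      | false =>
        refine hd.of_eq ?_ (by omega)
        rw [hR₁, hm']; simp
      | true =>
        refine (hd.seq (Runs.push N true _)).of_eq ?_ (by omega)
        rw [hR₁, hm']
        ext i : 1; simp only [Function.update_apply]; split_ifs <;> simp_all [List.replicate_succ]
    have ih := runs_binToUnary hAN hAN2 hN u m' R₁
      (by rw [hR₁]; simp only [Function.update_apply]; split_ifs <;> simp_all) (by rw [hR₁]; simp)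
      (by rw [hR₁]; simp only [Function.update_apply]; split_ifs <;> simp_all)
    have hV' : m' * 2 ^ u.length + msbVal u = V := by
      rw [hV, hm', msbVal, List.length_cons, pow_succ]; ring
    rw [hV'] at ih
    have hcost : 7 * m + 3 + 2 + (u.length * (7 * V + 5) + 1) ≤ (b :: u).length * (7 * V + 5) + 1 := by
      rw [List.length_cons, Nat.succ_mul]; nlinarith [hmV]
    cases b with
    | false =>
      refine (Runs.loop_false hA hb ih).of_eq ?_ hcost
      rw [hR₁]; ext i : 1; simp only [Function.update_apply]; split_ifs <;> simp_all
    | true =>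
      refine (Runs.loop_true hA hb ih).of_eq ?_ hcost
      rw [hR₁]; ext i : 1; simp only [Function.update_apply]; split_ifs <;> simp_all

/-! ### Adding two words -/

/-- The sum bit of a full adder. [folklore] -/
def sumBit (a c k : Bool) : Bool := Bool.xor (Bool.xor a c) k

/-- The carry bit of a full adder (majority). [folklore] -/
def carryBit (a c k : Bool) : Bool := (a && c) || (a && k) || (c && k)

/-- The full-adder identity. [folklore] -/
theorem fullAdder (a c k : Bool) :
    a.toNat + c.toNat + k.toNat = (sumBit a c k).toNat + 2 * (carryBit a c k).toNat := by
  cases a <;> cases c <;> cases k <;> rfl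

/-- Ripple-carry addition of the word `as` and (the first `|as|` bits of) `cs` with carry-in
`k`, least significant bit first, truncated to `|as|` bits. [folklore] -/
def addBits : List Bool → List Bool → Bool → List Bool
  | [], _, _ => []
  | a :: as, cs, k => sumBit a (cs.headD false) k :: addBits as cs.tail (carryBit a (cs.headD false) k)

/-- The carry out of `addBits`. [folklore] -/
def addCarry : List Bool → List Bool → Bool → Bool
  | [], _, k => k
  | a :: as, cs, k => addCarry as cs.tail (carryBit a (cs.headD false) k)

/-- `addBits` keeps the length of its first operand. [folklore] -/
@[simp] theorem length_addBits : ∀ (as cs : List Bool) (k : Bool), (addBits as cs k).length = as.length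
  | [], _, _ => rfl
  | a :: as, cs, k => by simp [addBits, length_addBits as]

/-- `(s + 2X) mod 2M = s + 2 (X mod M)` for a bit `s`. [folklore] -/
theorem bit_add_two_mul_mod (s X M : ℕ) (hs : s < 2) (hM : 0 < M) :
    (s + 2 * X) % (2 * M) = s + 2 * (X % M) := by
  have hr := Nat.mod_lt X hM
  conv_lhs => rw [← Nat.div_add_mod X M]
  rw [show s + 2 * (M * (X / M) + X % M) = 2 * M * (X / M) + (s + 2 * (X % M)) by ring,
    Nat.mul_add_mod, Nat.mod_eq_of_lt (by omega)]

/-- **`addBits` adds modulo `2^{|as|}`.** [folklore] -/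
theorem bitsToNat_addBits : ∀ (as cs : List Bool) (k : Bool),
    bitsToNat (addBits as cs k) = (bitsToNat as + bitsToNat (cs.take as.length) + k.toNat) % 2 ^ as.length
  | [], cs, k => by cases k <;> simp [addBits]
  | a :: as, cs, k => by
    have hc : ∀ cs : List Bool, bitsToNat (cs.take (as.length + 1)) =
        (cs.headD false).toNat + 2 * bitsToNat (cs.tail.take as.length) := by
      intro cs; cases cs <;> simp
    rw [addBits, bitsToNat_cons, bitsToNat_addBits as, List.length_cons, hc cs, bitsToNat_cons, pow_succ,
      mul_comm (2 ^ as.length) 2, ← bit_add_two_mul_mod _ _ _ (by cases sumBit a (cs.headD false) k <;> simp)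
      (Nat.two_pow_pos _)]
    congr 1
    have := fullAdder a (cs.headD false) k
    omega

/-- On words of one width `w`, `addBits` is addition modulo `2ʷ`. [folklore] -/
theorem addBits_natToWord (w x y : ℕ) :
    addBits (natToWord w x) (natToWord w y) false = natToWord w (x + y) := by
  have h := natToWord_bitsToNat (addBits (natToWord w x) (natToWord w y) false)
  rw [length_addBits, length_natToWord, bitsToNat_addBits, length_natToWord,
    List.take_of_length_le (by simp), bitsToNat_natToWord, bitsToNat_natToWord] at h
  rw [← h, natToWord_inj_iff]
  simp [Nat.add_mod]

/-- Set the (empty) carry register to the flag of `b`. [folklore] -/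
def setCarry (cy : ι) (b : Bool) : Com ι := bif b then push cy true else skip

/-- One full-adder step for the bits `a` (already popped) and `c`: read the carry, push the
sum bit on `D`, set the new carry. [folklore] -/
def waddCase (D cy : ι) (a c : Bool) : Com ι :=
  pop cy (push D (sumBit a c true) ;; setCarry cy (carryBit a c true))
    (push D (sumBit a c true) ;; setCarry cy (carryBit a c true))
    (push D (sumBit a c false) ;; setCarry cy (carryBit a c false))

/-- The body for the bit `a` of `A`: pop the corresponding bit of `C` (an exhausted `C` reads
`0`). [folklore] -/
def waddBody (C D cy : ι) (a : Bool) : Com ι :=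
  pop C (waddCase D cy a true) (waddCase D cy a false) (waddCase D cy a false)

/-- The adder loop over the bits of `A`. [folklore] -/
def waddLoop (A C D cy : ι) : Com ι := loop A (waddBody C D cy true) (waddBody C D cy false)

/-- `addWords A C D cy`: `A := A + C mod 2^{|A|}` (least significant bits on top; `C`
consumed up to `|A|` bits; `D`, `cy` empty scratch). [folklore] -/
def addWords (A C D cy : ι) : Com ι := waddLoop A C D cy ;; clear cy ;; pour D A

/-- Effect of `waddCase` from a carry flag. [folklore] -/
theorem runs_waddCase {D cy : ι} (hDc : D ≠ cy) (a c k : Bool) (R : Regs ι) (hcy : R cy = flag k) :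
    Runs (waddCase D cy a c) R (Function.update (Function.update R D (sumBit a c k :: R D)) cy
      (flag (carryBit a c k))) 4 := by
  have hset : ∀ (b : Bool) (S : Regs ι), S cy = [] →
      Runs (setCarry cy b) S (Function.update S cy (flag b)) 1 := by
    intro b S hS
    cases b
    · refine (Runs.skip _).of_eq ?_ (by omega)
      rw [flag_false, ← hS, Function.update_eq_self]
    · exact Runs.push' (by rw [hS, flag_true])
  cases k with
  | true =>
    rw [flag_true] at hcy
    refine (Runs.pop_true _ _ (w := []) hcy ((Runs.push D _ _).seq (hset _ _ ?_))).of_eq ?_ (by rfl)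
    · rw [Function.update_of_ne (Ne.symm hDc), Function.update_self]
    · ext i : 1; simp only [Function.update_apply]; split_ifs <;> simp_all
  | false =>
    rw [flag_false] at hcy
    refine (Runs.pop_nil _ _ hcy ((Runs.push D _ _).seq (hset _ _ ?_))).of_eq ?_ (by rfl)
    · rw [Function.update_of_ne (Ne.symm hDc), hcy]
    · ext i : 1; simp only [Function.update_apply]

/-- Effect of `waddBody`. [folklore] -/
theorem runs_waddBody {C D cy : ι} (hCD : C ≠ D) (hCc : C ≠ cy) (hDc : D ≠ cy) (a k : Bool)
    (R : Regs ι) (hcy : R cy = flag k) :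
    Runs (waddBody C D cy a) R (Function.update (Function.update (Function.update R C (R C).tail) D
      (sumBit a ((R C).headD false) k :: R D)) cy (flag (carryBit a ((R C).headD false) k))) 6 := by
  cases hC : R C with
  | nil =>
    refine (Runs.pop_nil _ _ hC (runs_waddCase hDc a false k R hcy)).of_eq ?_ (by rfl)
    rw [List.tail_nil, List.headD_nil, ← hC, Function.update_eq_self]
  | cons c rest =>
    have h' := runs_waddCase hDc a c k (Function.update R C rest)
      (by simp only [Function.update_apply]; split_ifs <;> simp_all)
    cases c
    · refine (Runs.pop_false _ _ hC h').of_eq ?_ (by rfl)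
      ext i : 1; simp only [Function.update_apply]; split_ifs <;> simp_all
    · refine (Runs.pop_true _ _ hC h').of_eq ?_ (by rfl)
      ext i : 1; simp only [Function.update_apply]; split_ifs <;> simp_all

/-- The adder loop. [folklore] -/
theorem runs_waddLoop {A C D cy : ι} (hAC : A ≠ C) (hAD : A ≠ D) (hAc : A ≠ cy) (hCD : C ≠ D)
    (hCc : C ≠ cy) (hDc : D ≠ cy) :
    ∀ (as : List Bool) (k : Bool) (R : Regs ι), R A = as → R cy = flag k →
      Runs (waddLoop A C D cy) R
        (Function.update (Function.update (Function.update (Function.update R A []) C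
          ((R C).drop as.length)) D ((addBits as (R C) k).reverse ++ R D)) cy
          (flag (addCarry as (R C) k))) (8 * as.length + 1)
  | [], k, R, hA, hcy => by
    refine (Runs.loop_nil _ _ hA).of_eq ?_ (by simp)
    ext i : 1; simp only [Function.update_apply]; split_ifs <;> simp_all [addBits, addCarry]
  | a :: as, k, R, hA, hcy => by
    have hb := runs_waddBody hCD hCc hDc a k (Function.update R A as)
      (by simp only [Function.update_apply]; split_ifs <;> simp_all)
    set R₁ := Function.update (Function.update (Function.update (Function.update R A as) C
      (Function.update R A as C).tail) D (sumBit a ((Function.update R A as C).headD false) k ::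
      Function.update R A as D)) cy (flag (carryBit a ((Function.update R A as C).headD false) k)) with hR₁
    have ih := runs_waddLoop hAC hAD hAc hCD hCc hDc as (carryBit a ((R C).headD false) k) R₁
      (by rw [hR₁]; simp only [Function.update_apply]; split_ifs <;> simp_all)
      (by rw [hR₁]; simp only [Function.update_apply]; split_ifs <;> simp_all)
    have hfin : Function.update (Function.update (Function.update (Function.update R₁ A []) C
        ((R₁ C).drop as.length)) D ((addBits as (R₁ C) (carryBit a ((R C).headD false) k)).reverse ++ R₁ D))
        cy (flag (addCarry as (R₁ C) (carryBit a ((R C).headD false) k))) =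
        Function.update (Function.update (Function.update (Function.update R A []) C
          ((R C).drop (a :: as).length)) D ((addBits (a :: as) (R C) k).reverse ++ R D)) cy
          (flag (addCarry (a :: as) (R C) k)) := by
      rw [hR₁]
      ext i : 1; simp only [Function.update_apply]
      split_ifs <;> simp_all [addBits, addCarry, List.drop_tail]
    rw [hfin] at ih
    cases a
    · exact (Runs.loop_false hA hb ih).of_eq rfl (by simp; omega)
    · exact (Runs.loop_true hA hb ih).of_eq rfl (by simp; omega)

/-- **Effect of `addWords`** on words: `A := addBits A C k` — the sum modulo `2^{|A|}`
(`bitsToNat_addBits`; on words of one width the word of the sum, `addBits_natToWord`), `C`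
loses its first `|A|` bits, `D` and `cy` are empty again; `11 |A| + 5` steps. [folklore] -/
theorem runs_addWords {A C D cy : ι} (hAC : A ≠ C) (hAD : A ≠ D) (hAc : A ≠ cy) (hCD : C ≠ D)
    (hCc : C ≠ cy) (hDc : D ≠ cy) (R : Regs ι) (hD : R D = []) (hcy : R cy = []) :
    Runs (addWords A C D cy) R
      (Function.update (Function.update R A (addBits (R A) (R C) false)) C ((R C).drop (R A).length))
      (11 * (R A).length + 5) := by
  have h1 := runs_waddLoop hAC hAD hAc hCD hCc hDc (R A) false R rfl (by rw [hcy, flag_false])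
  set R₁ := Function.update (Function.update (Function.update (Function.update R A []) C
    ((R C).drop (R A).length)) D ((addBits (R A) (R C) false).reverse ++ R D)) cy
    (flag (addCarry (R A) (R C) false)) with hR₁
  have h2 : Runs (clear cy) R₁ (Function.update R₁ cy []) 3 :=
    runs_clear_flag cy (by rw [hR₁]; simp [length_flag_le])
  have h3 := runs_pour hAD.symm (Function.update R₁ cy [])
  refine (h1.seq (h2.seq h3)).of_eq ?_ ?_
  · rw [hR₁]
    ext i : 1; simp only [Function.update_apply]; split_ifs <;> simp_all
  · rw [hR₁]; simp [hD, hDc]; omega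

end Com

end Literature.Computability.Complexity
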